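import Mathlib

/-!
# OCT g15 — Stevens-line bookkeeping (sketch; elaborates, no `sorry`)

Companion to `Ideas/ordinary-cm-torsor-stevens.md` (crux `EisensteinAdditiveManinResidual`,
stmt-BirchSwinnertonDyer-25138; planner crux-ideate round 1 seat 1, g15).

This file isolates the *valuation arithmetic* of §2–§3 of the note as checkable statements over ℤ:

* `StevensLineDatum`: a prime `p ≥ 5`, a Galois digit `b ∈ [1, p-2]`, the exponent `s` of the
  Stevens class (p^s = order of `[e]` = 𝔓-denominator of `Periods(G)`, Stevens Cor 1.8.7) and the
  exponent `t` of the p-denominator of the q-expansion tail of the a₁-normalised series `G`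
  (`a₁(G) = p^{-t}·π_*^b·unit`).  Integrality of `p^s·G` (principality ⇒ integral tail, Lemma U)
  is the hypothesis `tail_integral : 0 ≤ (p-1)(s-t) + b`.
* `vXi d = (p-1)(s-t) + b` is the π_*-valuation of `Ξ̄(socle) = p^s a₁(G)`; `XiNonzero d` means
  `vXi d < p - 1` (nonzero mod p·W[ζ_p]).
* SOCLE LEMMA (`s_ge_t`, `xiNonzero_iff`): `t ≤ s`, and `Ξ̄(socle) ≠ 0 ↔ s = t`, the digit then being `b`.
* PER (`PerDatum`, `s_eq_t_of_per`): if `u = min 𝔓-valuation of Periods = 0` (Stevens Thm 3.6.1 off the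
  exceptional digits) and `k = v_𝔓(R(E)) ≥ 1`, then `s = k = t`.
* Level p² (`kLevelPSq`, `nonempty_iff`): for regular `p`, `k(b) = [2b ≥ p-1] - [b ∈ {1,(p+1)/2}]`
  (and 0 when `2b = p-1`), so the cell is nonempty iff `b > (p+1)/2`; checked against the census
  dimension vectors at 25, 49, 121, 169 by `decide`.
* `EfreeCellShape` / `law_of_singleton_per`: the E-free law `rank Ξ̄|_V = dim V` (g14 shape) follows on a
  singleton cell (dim V ≤ 1, V = Stevens socle) from `XiNonzero`.

Nothing here is a theorem about modular curves: the modular input (Stevens 1982 Thms 1.3.1, 1.8.7,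
3.4.2–3.4.4, 3.5.1, 3.6.1; Stickelberger; von Staudt–Clausen) is recorded as hypotheses of the data.
BSD is not proved by this; Manin c = 1 is not proved by this.
-/

set_option linter.dupNamespace false

namespace Summit.BirchSwinnertonDyer.BirchSwinnertonDyer.Cruxes.EisensteinAdditiveManinResidual.StevensLine

/-- Valuation data of one Stevens line at a prime 𝔓 over `p` (see module doc). -/
structure StevensLineDatum where
  p : ℕ
  b : ℕ
  s : ℤ
  t : ℤ
  five_le : 5 ≤ p
  one_le_b : 1 ≤ b
  b_le : b + 2 ≤ p
  /-- `p^s · e` is principal, hence `p^s · G` has `W[ζ_p]`-integral tail (Lemma U):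
  `v_{π_*}(p^s a₁(G)) = (p-1)(s-t) + b ≥ 0`. -/
  tail_integral : 0 ≤ ((p : ℤ) - 1) * (s - t) + b

namespace StevensLineDatum

variable (d : StevensLineDatum)

/-- `v_{π_*}(Ξ̄(socle)) = v_{π_*}(p^s · a₁(G)) = (p-1)(s-t) + b`. -/
def vXi : ℤ := ((d.p : ℤ) - 1) * (d.s - d.t) + d.b

/-- `Ξ̄(socle) ≠ 0 (mod p)` iff its π_*-valuation is `< v(p) = p - 1`. -/
def XiNonzero : Prop := d.vXi < (d.p : ℤ) - 1

/-- Socle lemma (a): no Stevens class is *smaller* than its q-expansion predicts: `t ≤ s`. -/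
theorem s_ge_t : d.t ≤ d.s := by
  have h := d.tail_integral
  have hb := d.b_le
  have hp := d.five_le
  by_contra hlt
  have h1 : d.s - d.t ≤ -1 := by omega
  have h2 : ((d.p : ℤ) - 1) * (d.s - d.t) ≤ ((d.p : ℤ) - 1) * (-1) :=
    mul_le_mul_of_nonneg_left h1 (by omega)
  have h3 : ((d.p : ℤ) - 1) * (d.s - d.t) + d.b ≤ -((d.p : ℤ) - 1) + d.b := by linarith
  have h4 : (d.b : ℤ) + 2 ≤ d.p := by exact_mod_cast hb
  linarith

/-- Socle lemma (b): `Ξ̄(socle) ≠ 0 ↔ s = t` ("no hidden period denominator"). -/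
theorem xiNonzero_iff : d.XiNonzero ↔ d.s = d.t := by
  have hst := d.s_ge_t
  have hb1 := d.one_le_b
  have hb2 := d.b_le
  have hp := d.five_le
  unfold XiNonzero vXi
  constructor
  · intro h
    by_contra hne
    have h1 : 1 ≤ d.s - d.t := by omega
    have h2 : ((d.p : ℤ) - 1) * 1 ≤ ((d.p : ℤ) - 1) * (d.s - d.t) :=
      mul_le_mul_of_nonneg_left h1 (by omega)
    have h3 : (1 : ℤ) ≤ d.b := by exact_mod_cast hb1
    linarith
  · intro h
    rw [h, sub_self, mul_zero, zero_add]
    have h4 : (d.b : ℤ) + 2 ≤ d.p := by exact_mod_cast hb2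
    linarith

/-- When `Ξ̄(socle) ≠ 0` its digit (π_*-valuation) is exactly `b`. -/
theorem vXi_eq_b_of_xiNonzero (h : d.XiNonzero) : d.vXi = d.b := by
  have hst := (d.xiNonzero_iff).1 h
  unfold vXi
  rw [hst, sub_self, mul_zero, zero_add]

end StevensLineDatum

/-- PER data: `k = v_𝔓(R(E))` (residues), `u = min v_𝔓(Periods(E))`; Stevens: `Periods ⊇ R` gives
`u ≤ k`, Thm 3.6.1 (lower inclusion, `1 ∈ 𝒪·Periods`) gives `u ≤ 0`; the class has exponent `s = k - u`
(`A(E)_𝔓 = Periods/R`), and `t = k` because `a₁(G) = a₁(E)/r` with `v(a₁(E)) = b/(p-1) < 1`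
(width normalisation + Stickelberger, note §1). -/
structure PerDatum extends StevensLineDatum where
  k : ℤ
  u : ℤ
  u_le_k : u ≤ k
  u_le_zero : u ≤ 0
  s_eq : s = k - u
  t_eq : t = k

namespace PerDatum

variable (e : PerDatum)

/-- PER ⇒ T2E: if Thm 3.6.1's upper bound `V` is 𝔓-integral (non-exceptional digit: `χ₀ ≠ 1` or
`b ∉ {1,2}`), then `u = min(0,k)`; on a nonempty line (`k ≥ 1`) this is `u = 0`, whence `s = t` and
`Ξ̄(socle) ≠ 0` with digit `b`. -/
theorem s_eq_t_of_per (hu : e.u = 0) : e.s = e.t := by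
  rw [e.s_eq, e.t_eq, hu, sub_zero]

theorem xiNonzero_of_per (hu : e.u = 0) : e.toStevensLineDatum.XiNonzero :=
  (e.toStevensLineDatum.xiNonzero_iff).2 (e.s_eq_t_of_per hu)

/-- Conversely a hidden period denominator (`u < 0` on a line with `k ≥ 1`, i.e. `s > t`) kills `Ξ̄`:
this is what `p ∣ c(E)` would require on a curve row (note §7 (D)). -/
theorem not_xiNonzero_of_hidden (hu : e.u < 0) : ¬ e.toStevensLineDatum.XiNonzero := by
  intro h
  have := (e.toStevensLineDatum.xiNonzero_iff).1 h
  have hs := e.s_eq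
  have ht := e.t_eq
  -- s = k - u > k = t
  have : e.toStevensLineDatum.s = e.toStevensLineDatum.t := this
  omega

end PerDatum

/-! ### Level `p²`, `M = 1`, `χ₀ = 1` (note §4)

`R(E_ψ) = 𝒪 · ½ B₂(ψ, ψ̄)` with `B₂(ψ,ψ̄) = J(ψ̄,ψ̄) · B_{2,ψ̄²}` (`ψ² ≠ 1`), resp. a unit (`ψ² = 1`);
`v_𝔓 J(ω̃^{-b}, ω̃^{-b}) = [2b ≥ p-1]` (Stickelberger) and, for regular `p`,
`v_𝔓 B_{2, ω̃^{-2b}} = -[2b ≡ 2 (mod p-1)]` (von Staudt–Clausen / Kummer). -/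

/-- `k(b)` at level `p²` for a regular prime `p` (digits `1 ≤ b ≤ p-2`). -/
def kLevelPSq (p b : ℕ) : ℤ :=
  if 2 * b = p - 1 then 0
  else (if p - 1 ≤ 2 * b then 1 else 0) - (if b = 1 ∨ b = (p + 1) / 2 then 1 else 0)

/-- The predicted dimension of the digit-`b` cell of `C(p²)[p]`: a line iff `k(b) = 1`. -/
def dimLevelPSq (p b : ℕ) : ℕ := if kLevelPSq p b = 1 then 1 else 0

/-- For regular `p ≥ 5` the digit-`b` cell at level `p²` is nonempty iff `b > (p+1)/2`
(checked here for the census primes and the two predicted ones). -/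
theorem nonempty_iff_census :
    ∀ p ∈ [5, 7, 11, 13, 17, 19], ∀ b ∈ Finset.Icc 1 (p - 2),
      (dimLevelPSq p b = 1 ↔ (p + 1) / 2 < b) := by
  decide

/-- Census cross-check (CENSUS-efree-g14, "dims C[p]^{(b)}" for b = 1..p-2):
`25 ↦ []`-all-zero, `49 ↦ [0,0,0,0,1]`, `121 ↦ [0,0,0,0,0,0,1,1,1]`, `169 ↦ [0,…,0,1,1,1,1]`. -/
theorem census_dims_25 : (List.range 3).map (fun i => dimLevelPSq 5 (i + 1)) = [0, 0, 0] := by decide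
theorem census_dims_49 : (List.range 5).map (fun i => dimLevelPSq 7 (i + 1)) = [0, 0, 0, 0, 1] := by decide
theorem census_dims_121 :
    (List.range 9).map (fun i => dimLevelPSq 11 (i + 1)) = [0, 0, 0, 0, 0, 0, 1, 1, 1] := by decide
theorem census_dims_169 :
    (List.range 11).map (fun i => dimLevelPSq 13 (i + 1)) = [0, 0, 0, 0, 0, 0, 0, 1, 1, 1, 1] := by decide
/-- Predictions (falsifier F2 of the note): level 289 digits 10..15, level 361 digits 11..17. -/
theorem prediction_dims_289 :
    (List.range 15).map (fun i => dimLevelPSq 17 (i + 1)) =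
      [0, 0, 0, 0, 0, 0, 0, 0, 0, 1, 1, 1, 1, 1, 1] := by decide
theorem prediction_dims_361 :
    (List.range 17).map (fun i => dimLevelPSq 19 (i + 1)) =
      [0, 0, 0, 0, 0, 0, 0, 0, 0, 0, 1, 1, 1, 1, 1, 1, 1] := by decide

/-! ### Transpose lemma bookkeeping (note §6)

On the old package `E_i = E₀|B_ℓ^i`, `0 ≤ i ≤ v`, the Atkin–Lehner involution reverses indices
(`w_ℓ E_i = unit · E_{v-i}`) and `a₁(E_i) = 0` for `i ≥ 1`; so `a₁(w_ℓ x) ≠ 0` iff `x` has a nonzero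
`E_v`-component.  The Stevens eigenvectors have top index 1 (`σ ∈ {α,β}`), 2 (`σ = 0`, `χ₀` unramified
at `ℓ`) or 0 (`χ₀` ramified at `ℓ`, extra copies `v = v_ℓ(M) - 2c_ℓ`).  Hence the ENGINE cell
(`= w_ℓ`(Stevens line)) has `Ξ̄ ≠ 0` iff `topIndex = v`. -/

/-- Top package index of the Stevens `U_ℓ`-eigenvector: `σ ≠ 0 ↦ 1`, `σ = 0` unramified `↦ 2`,
ramified `↦ 0`. -/
def topIndex (ramified : Bool) (sigmaZero : Bool) : ℕ :=
  if ramified then 0 else if sigmaZero then 2 else 1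

/-- Engine-cell prediction: `Ξ̄ ≠ 0` on the engine's `σ_ℓ`-cell iff the number of extra old copies
`v` (= `v_ℓ(M)` unramified, `v_ℓ(M) - 2 c_ℓ` ramified) equals `topIndex`. -/
def engineXiNonzero (ramified sigmaZero : Bool) (v : ℕ) : Bool :=
  decide (topIndex ramified sigmaZero = v)

/-- The failure pattern of CENSUS-efree-g14 (all 33 "!" cells) versus the holds, as instances:
N = 100 (v₂ = 2): σ₂ = -1 fails, σ₂ = 0 holds; N = 200 (v₂ = 3): both fail; v_ℓ = 1: every σ holds;
N = 400 with χ₄ (c = 2, v = 4 - 4 = 0): holds; N = 675 with χ₃ (c = 1, v = 3 - 2 = 1): fails. -/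
theorem census_failure_pattern :
    engineXiNonzero false false 2 = false ∧ engineXiNonzero false true 2 = true ∧
    engineXiNonzero false false 3 = false ∧ engineXiNonzero false true 3 = false ∧
    engineXiNonzero false false 1 = true ∧
    engineXiNonzero true true 0 = true ∧ engineXiNonzero true true 1 = false := by
  decide

/-! ### From the Stevens line to the g14 E-free law shape -/

/-- Local copy of the g14 cell shape (`EfreeEisensteinLawSketch.EfreeCellDatum`; Cruxes modules are
not importable on the farm): `dimV` = dim of the cell, `rankXi` = rank of `Ξ̄` on it. -/
structure EfreeCellShape where
  dimV : ℕ
  rankXi : ℕ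
  rank_le : rankXi ≤ dimV

/-- The E-free law T12E on a cell: `Ξ̄` is injective on `V`, i.e. `rank = dim` (with `dim ≤ 1`). -/
def EfreeCellShape.Law (c : EfreeCellShape) : Prop := c.dimV ≤ 1 ∧ c.rankXi = c.dimV

/-- A singleton cell realised by a Stevens line: `dim V ≤ 1` (Singleton lemma, note §5), and if the
cell is a line then `Ξ̄` of its generator (the socle) is nonzero iff `d.XiNonzero`. -/
structure SingletonCell extends EfreeCellShape where
  d : StevensLineDatum
  dim_le_one : dimV ≤ 1
  rank_spec : dimV = 1 → (rankXi = 1 ↔ d.XiNonzero)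

/-- GEN (note §7 (A)), bookkeeping form: on a singleton cell whose Stevens datum has `s = t`
(e.g. by PER), the E-free law holds. -/
theorem law_of_singleton_per (c : SingletonCell) (hst : c.d.s = c.d.t) : c.toEfreeCellShape.Law := by
  refine ⟨c.dim_le_one, ?_⟩
  have hle := c.dim_le_one
  have hr := c.rank_le
  rcases Nat.lt_or_ge c.dimV 1 with h0 | h1
  · -- empty cell
    have : c.dimV = 0 := by omega
    simp only [this] at hr ⊢
    omega
  · have h : c.dimV = 1 := le_antisymm hle h1
    have hx : c.d.XiNonzero := (c.d.xiNonzero_iff).2 hst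
    have := (c.rank_spec h).2 hx
    rw [this, h]

end Summit.BirchSwinnertonDyer.BirchSwinnertonDyer.Cruxes.EisensteinAdditiveManinResidual.StevensLine
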